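import Mathlib.LinearAlgebra.BilinearForm.DualLattice
import Mathlib.Analysis.InnerProductSpace.Basic
import Mathlib.Algebra.Module.ZLattice.Covolume
import HarnessLib

-- provenance: harness21/H21/H21/Prelude/Lattice/DualLattice.lean @ efa73f9 (interim HEAD d8f2665); M5 mechanical rewrite
/-!
# The dual lattice (trunk T-LATTICE, G10)

For a real inner product space `E` and a `ℤ`-submodule `L ⊆ E`, the *dual lattice* is
`L* = {x ∈ E | ⟪x, y⟫ ∈ ℤ for all y ∈ L}` (Peikert 2016, Def. 2.1.4; Micciancio–Goldwasser 2002,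
Ch. 1).  When `L` is a full-rank `ℤ`-lattice (`[DiscreteTopology L] [IsZLattice ℝ L]`), so is `L*`;
it is spanned by the dual basis of any `ℤ`-basis of `L`, `L** = L`, and (for the canonical Lebesgue
measure of the inner product space) `covol(L*) = covol(L)⁻¹`.

## Mathlib

Mathlib has the general `LinearMap.BilinForm.dualSubmodule B N` of a submodule with respect to a
bilinear form (`Mathlib/LinearAlgebra/BilinearForm/DualLattice.lean`) together with
`dualSubmodule_span_of_basis` and `dualSubmodule_dualSubmodule_of_basis`, and the bilinear form
`innerₗ E` with `isSymm_inner`.  We specialise: `dualLattice L := (innerₗ E).dualSubmodule L`.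
Mathlib has no lemma stating that `innerₗ E` is nondegenerate; we prove `innerₗ_nondegenerate` here
(it is the hypothesis consumed by `LinearMap.BilinForm.dualBasis` and the `…_of_basis` lemmas).

## Design

* Generality: `[NormedAddCommGroup E] [InnerProductSpace ℝ E]`; the lattice results assume
  `[FiniteDimensional ℝ E]` (which follows from `IsZLattice ℝ L` but is assumed for convenience, as
  in `Mathlib/Algebra/Module/ZLattice/Covolume.lean`).
* The instances `DiscreteTopology (dualLattice L)` and `IsZLattice ℝ (dualLattice L)` are derived, with
  real proofs, from `dualLattice_eq_span_dualBasis` and Mathlib's `ZSpan` instances.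
* `covolume_dualLattice` is stated for the canonical `volume` of `measureSpaceOfInnerProductSpace` only;
  it is false for a rescaled Haar measure.

## References

* C. Peikert, *A decade of lattice cryptography*, Found. Trends TCS 10 (2016), Def. 2.1.4.
* D. Micciancio, S. Goldwasser, *Complexity of lattice problems*, Kluwer (2002), Ch. 1.
-/

noncomputable section

open Module Submodule
open scoped InnerProductSpace

namespace Literature.Algebra.EuclideanLattices

section Lattice

variable {E : Type*} [NormedAddCommGroup E] [InnerProductSpace ℝ E]

/-- The real inner product, as a bilinear form `innerₗ E`, is nondegenerate: if `⟪x, y⟫ = 0` for all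
`y` then `x = 0` (take `y = x` and use `inner_self_eq_zero`), and symmetrically.  Mathlib does not
record this; it is the hypothesis `hB` of `LinearMap.BilinForm.dualBasis` and of
`LinearMap.BilinForm.dualSubmodule_span_of_basis` (Peikert 2016, §2.1). [cite: Peikert2016, §2.1] -/
theorem innerₗ_nondegenerate : (innerₗ E : LinearMap.BilinForm ℝ E).Nondegenerate := by
  refine ⟨fun x hx => ?_, fun y hy => ?_⟩
  · simpa only [innerₗ_apply_apply, inner_self_eq_zero] using hx x
  · simpa only [innerₗ_apply_apply, inner_self_eq_zero] using hy y

/-- The *dual lattice* `L* = {x ∈ E | ∀ y ∈ L, ⟪x, y⟫ ∈ ℤ}` of a `ℤ`-submodule `L` of a real inner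
product space, defined as Mathlib's `LinearMap.BilinForm.dualSubmodule` for the bilinear form
`innerₗ E` (Peikert 2016, Def. 2.1.4; Micciancio–Goldwasser 2002, Ch. 1). [cite: Peikert2016, Def. 2.1.4] -/
def dualLattice (L : Submodule ℤ E) : Submodule ℤ E :=
  LinearMap.BilinForm.dualSubmodule (innerₗ E : LinearMap.BilinForm ℝ E) L

/-- Membership in the dual lattice: `x ∈ L*` iff `⟪x, y⟫ ∈ ℤ` for every `y ∈ L`
(Peikert 2016, Def. 2.1.4). [cite: Peikert2016, Def. 2.1.4] -/
theorem mem_dualLattice {L : Submodule ℤ E} {x : E} :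
    x ∈ dualLattice L ↔ ∀ y ∈ L, ∃ n : ℤ, (n : ℝ) = ⟪x, y⟫_ℝ := by
  simp [dualLattice, LinearMap.BilinForm.mem_dualSubmodule, Submodule.mem_one]

/-- The dual lattice is antitone: `L₁ ≤ L₂ → L₂* ≤ L₁*` (Micciancio–Goldwasser 2002, Ch. 1). [cite: MicciancioGoldwasser2002, Ch. 1] -/
theorem dualLattice_anti {L₁ L₂ : Submodule ℤ E} (h : L₁ ≤ L₂) :
    dualLattice L₂ ≤ dualLattice L₁ :=
  fun _ hx y hy => hx y (h hy)

/-- The dual of the zero submodule is everything: `(⊥)* = ⊤` (Micciancio–Goldwasser 2002, Ch. 1). [cite: MicciancioGoldwasser2002, Ch. 1] -/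
@[simp]
theorem dualLattice_bot : dualLattice (⊥ : Submodule ℤ E) = ⊤ := by
  refine eq_top_iff.mpr fun x _ => mem_dualLattice.mpr fun y hy => ⟨0, ?_⟩
  rw [(Submodule.mem_bot ℤ).mp hy, inner_zero_right, Int.cast_zero]

/-- The dual lattice is closed under negation (it is a subgroup); convenience restatement
(Peikert 2016, Def. 2.1.4). [cite: Peikert2016, Def. 2.1.4] -/
theorem neg_mem_dualLattice {L : Submodule ℤ E} {x : E} (hx : x ∈ dualLattice L) :
    -x ∈ dualLattice L :=
  neg_mem hx

section IsZLattice

variable [FiniteDimensional ℝ E] (L : Submodule ℤ E) [DiscreteTopology L] [IsZLattice ℝ L]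

/-- If `b` is a `ℤ`-basis of the full-rank lattice `L`, then `L*` is the `ℤ`-span of the dual basis
`b^∨` (with `⟪b^∨ᵢ, bⱼ⟫ = δᵢⱼ`) of the associated `ℝ`-basis of `E` (Peikert 2016, §2.1, "the dual
basis is a basis of the dual lattice"; Micciancio–Goldwasser 2002, Ch. 1).  Proved from Mathlib's
`LinearMap.BilinForm.dualSubmodule_span_of_basis` and `Basis.ofZLatticeBasis_span`. [cite: Peikert2016, §2.1  "the dual basis is a basis of the] -/
theorem dualLattice_eq_span_dualBasis {ι : Type*} [Fintype ι] [DecidableEq ι] (b : Basis ι ℤ L) :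
    dualLattice L = span ℤ (Set.range
      (LinearMap.BilinForm.dualBasis (innerₗ E : LinearMap.BilinForm ℝ E) innerₗ_nondegenerate
        (b.ofZLatticeBasis ℝ L))) := by
  rw [← LinearMap.BilinForm.dualSubmodule_span_of_basis _ innerₗ_nondegenerate,
    b.ofZLatticeBasis_span ℝ L]
  rfl

/-- The dual of a full-rank lattice is discrete (Micciancio–Goldwasser 2002, Ch. 1); derived from
`dualLattice_eq_span_dualBasis` and Mathlib's `ZSpan` instance. [cite: MicciancioGoldwasser2002, Ch. 1] -/
instance instDiscreteTopologyDualLattice : DiscreteTopology (dualLattice L) := by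
  classical
  rw [dualLattice_eq_span_dualBasis L (Module.Free.chooseBasis ℤ L)]
  infer_instance

/-- The dual of a full-rank lattice is a full-rank lattice (Peikert 2016, §2.1;
Micciancio–Goldwasser 2002, Ch. 1); derived from `dualLattice_eq_span_dualBasis` and Mathlib's
`instIsZLatticeRealSpan`. [cite: Peikert2016, §2.1] -/
instance instIsZLatticeDualLattice : IsZLattice ℝ (dualLattice L) := by
  classical
  have h := dualLattice_eq_span_dualBasis L (Module.Free.chooseBasis ℤ L)
  refine ⟨?_⟩
  rw [h]
  exact (instIsZLatticeRealSpan _).span_top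

/-- Biduality: `L** = L` for a full-rank lattice `L` (Peikert 2016, §2.1; Micciancio–Goldwasser 2002,
Ch. 1).  Via `LinearMap.BilinForm.dualSubmodule_dualSubmodule_of_basis innerₗ_nondegenerate
isSymm_inner`. [cite: Peikert2016, §2.1] -/
theorem dualLattice_dualLattice : dualLattice (dualLattice L) = L := by
  classical
  have h := LinearMap.BilinForm.dualSubmodule_dualSubmodule_of_basis (R := ℤ)
    (innerₗ E : LinearMap.BilinForm ℝ E) innerₗ_nondegenerate
    (LinearMap.BilinForm.isSymm_iff.mpr isSymm_inner)
    ((Module.Free.chooseBasis ℤ L).ofZLatticeBasis ℝ L)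
  rwa [Basis.ofZLatticeBasis_span] at h

/-- The dual lattice has the same rank: `finrank ℤ L* = finrank ℤ L` (`= finrank ℝ E`)
(Micciancio–Goldwasser 2002, Ch. 1). [cite: MicciancioGoldwasser2002, Ch. 1] -/
theorem finrank_dualLattice : finrank ℤ (dualLattice L) = finrank ℤ L := by
  rw [ZLattice.rank ℝ (dualLattice L), ZLattice.rank ℝ L]

/-- Covolume of the dual lattice: `covol(L*) = covol(L)⁻¹`, i.e. `det(L*) = 1 / det(L)`
(Peikert 2016, §2.1; Micciancio–Goldwasser 2002, Ch. 1).  This is stated for the *canonical* Lebesgue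
measure `volume` of `measureSpaceOfInnerProductSpace` ONLY (an orthonormal parallelepiped has volume
`1`); the identity is false for a rescaled Haar measure `c • volume` (both sides scale by `c`). [cite: Peikert2016, §2.1] -/
def covolume_dualLattice : Prop :=
  ∀ [MeasurableSpace E] [BorelSpace E],
    ZLattice.covolume (dualLattice L) = (ZLattice.covolume L)⁻¹

end IsZLattice

end Lattice

end Literature.Algebra.EuclideanLattices
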